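import Summits.ABC.IUTFork.Conditional.HexRefutedBandMTwinsA
import HarnessLib

/-!
# HEX `k = 9`, M LINE: S_H at the summand-route M-level setting REFUTED at every genuine datum over `(ratPoint (1/2 + 2/7^9), l)` for EVERY prime
# `11 ≤ l ≤ 337` — the M twin of `GenuineK.not_pilotKummerCompatHull_chosen_lamSeven_nine_le` (row «W:REF-EXACT-M-TWIN», HEX part)

PROOF-ONLY file (D-0012; 0 definitions, 0 `Prop` facts, no instance) of the abc-iut cell — D-0079 RESCUE sub-cell R-W «WINDOW Θ-SIDE INEQUALITY», seat
abc-iut-W-neg-1 (gen 6). TAKES NO SIDE on [IUTchIII] Cor. 3.12 or on any author; «refuted as typed» ≠ «refuted in print». The K glue (abc-iut-C-cert-1's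
`WRowHexLamSevenNineRefutedGap`) covers `l ≤ 317` by abc-iut-W-neg-2's K-only rad theorem `HexRad.…_rad_nine_all` and `{331, 337}` by the hull-cell gap
file (`318 … 330` holds no prime); on the M line both pieces go through this seat's `GenuineM.not_pilotKummerCompatHull_triple_of_hullCells_tameSharp`
(p528325): the integer cells below (`RefBand.not_hullCell_hex9low_A<A>_a<a₀>`, `RefBand.cells_hex9_low`: class `A ∈ {5, 10}` at `(7, v = 9)`, every odd
`11 ≤ l ≤ 317`, desk-exact, floor-free) and the gap twin `GenuineM.not_pilotKummerCompatHull_triple_lamSeven_nine_gap` (`HexRefutedBandMTwinsA`).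
SAME binders as the K theorem (the M place over `7` is `placeOfPrimeQ 7`). The inhabited side, admissibility / (P6) / non-emptiness NOT claimed; record counts
UNCHANGED; typed ≠ proved; no abc claim. [cite: Mochizuki2012, IUTchIII Cor. 3.12 Step (xi-f) p. 184; IUTchIV Prop. 1.1 p. 9, Prop. 1.2 (i)(ii) p. 10]
[cite: DupuyHilado2025, §4.9] [claim: Mochizuki2012, status: disputed]
-/

noncomputable section

open Set Function Metric NumberField IsDedekindDomain

namespace Summit.ABC.IUTFork.Conditional

open Thm311 Thm311.Real Cor312 Cor312Vol Cor312Prov Literature.IUT.LogThetaLattice Literature.IUT.LogVolume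
  Literature.IUT.HodgeTheaters Literature.IUT.LogVolume.ThetaData Literature.IUT.LogVolume.Cor22
open Literature.NumberTheory.NumberFields Literature.NumberTheory.GaloisRepresentations.Ultrametric
open Literature.NumberTheory.DiophantineGeometry Literature.NumberTheory.DiophantineGeometry.GenEll Summit.ABC.ABC.Theorems
open Summit.ABC.IUTFork.Repair.RH.HullThresholdExact

/-! ## §1. The integer cells at `(7, v = 9)`, `11 ≤ l ≤ 317`, class `A ∈ {5, 10}` -/

/-- Floor-free failure of the top-label cell, `k = 9`, member `A = 5` (`e = 5l`, `m = 45`), turning point `a₀ = 2`, `5 ≤ j ≤ 28`. [folklore] -/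
theorem RefBand.not_hullCell_hex9low_A5_a2 {j rin : ℤ} (hlo : 5 ≤ j) (hhi : j ≤ 28) (hrin : 6 * rin ≤ 5 * (2 * j + 1) + 6) :
    ¬ HullCell (5 * (2 * j + 1)) 45 j rin (49 - 2 * (5 * (2 * j + 1))) := by
  intro hc
  unfold HullCell at hc
  set e : ℤ := 5 * (2 * j + 1) with he
  have he0 : 0 < e := by rw [he]; omega
  set X : ℤ := j ^ 2 * 45 - j * (e - 1) - (j + 1) * rin with hX
  have hdiv : X - e < e * (X / e) := by
    have h1 := Int.emod_add_mul_ediv X e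
    have h2 := Int.emod_lt_of_pos X he0
    have h3 := Int.emod_nonneg X he0.ne'
    nlinarith [h1, h2, h3]
  have hk1 : 0 ≤ (28 - j) * (j + 1) := mul_nonneg (by omega) (by omega)
  have hk2 : 0 ≤ (28 - j) * (j - 5) := mul_nonneg (by omega) (by omega)
  nlinarith [hdiv, hk1, hk2, hc, hrin, hX]

/-- Floor-free failure of the top-label cell, `k = 9`, member `A = 5` (`e = 5l`, `m = 45`), turning point `a₀ = 3`, `29 ≤ j ≤ 158`. [folklore] -/
theorem RefBand.not_hullCell_hex9low_A5_a3 {j rin : ℤ} (hlo : 29 ≤ j) (hhi : j ≤ 158) (hrin : 6 * rin ≤ 5 * (2 * j + 1) + 6) :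
    ¬ HullCell (5 * (2 * j + 1)) 45 j rin (343 - 3 * (5 * (2 * j + 1))) := by
  intro hc
  unfold HullCell at hc
  set e : ℤ := 5 * (2 * j + 1) with he
  have he0 : 0 < e := by rw [he]; omega
  set X : ℤ := j ^ 2 * 45 - j * (e - 1) - (j + 1) * rin with hX
  have hdiv : X - e < e * (X / e) := by
    have h1 := Int.emod_add_mul_ediv X e
    have h2 := Int.emod_lt_of_pos X he0
    have h3 := Int.emod_nonneg X he0.ne'
    nlinarith [h1, h2, h3]
  have hk1 : 0 ≤ (158 - j) * (j + 1) := mul_nonneg (by omega) (by omega)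
  have hk2 : 0 ≤ (158 - j) * (j - 29) := mul_nonneg (by omega) (by omega)
  nlinarith [hdiv, hk1, hk2, hc, hrin, hX]

/-- Floor-free failure of the top-label cell, `k = 9`, member `A = 10` (`e = 10l`, `m = 90`), turning point `a₀ = 2`, `5 ≤ j ≤ 14`. [folklore] -/
theorem RefBand.not_hullCell_hex9low_A10_a2 {j rin : ℤ} (hlo : 5 ≤ j) (hhi : j ≤ 14) (hrin : 6 * rin ≤ 10 * (2 * j + 1) + 6) :
    ¬ HullCell (10 * (2 * j + 1)) 90 j rin (49 - 2 * (10 * (2 * j + 1))) := by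
  intro hc
  unfold HullCell at hc
  set e : ℤ := 10 * (2 * j + 1) with he
  have he0 : 0 < e := by rw [he]; omega
  set X : ℤ := j ^ 2 * 90 - j * (e - 1) - (j + 1) * rin with hX
  have hdiv : X - e < e * (X / e) := by
    have h1 := Int.emod_add_mul_ediv X e
    have h2 := Int.emod_lt_of_pos X he0
    have h3 := Int.emod_nonneg X he0.ne'
    nlinarith [h1, h2, h3]
  have hk1 : 0 ≤ (14 - j) * (j + 1) := mul_nonneg (by omega) (by omega)
  have hk2 : 0 ≤ (14 - j) * (j - 5) := mul_nonneg (by omega) (by omega)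
  nlinarith [hdiv, hk1, hk2, hc, hrin, hX]

/-- Floor-free failure of the top-label cell, `k = 9`, member `A = 10` (`e = 10l`, `m = 90`), turning point `a₀ = 3`, `15 ≤ j ≤ 102`. [folklore] -/
theorem RefBand.not_hullCell_hex9low_A10_a3 {j rin : ℤ} (hlo : 15 ≤ j) (hhi : j ≤ 102) (hrin : 6 * rin ≤ 10 * (2 * j + 1) + 6) :
    ¬ HullCell (10 * (2 * j + 1)) 90 j rin (343 - 3 * (10 * (2 * j + 1))) := by
  intro hc
  unfold HullCell at hc
  set e : ℤ := 10 * (2 * j + 1) with he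
  have he0 : 0 < e := by rw [he]; omega
  set X : ℤ := j ^ 2 * 90 - j * (e - 1) - (j + 1) * rin with hX
  have hdiv : X - e < e * (X / e) := by
    have h1 := Int.emod_add_mul_ediv X e
    have h2 := Int.emod_lt_of_pos X he0
    have h3 := Int.emod_nonneg X he0.ne'
    nlinarith [h1, h2, h3]
  have hk1 : 0 ≤ (102 - j) * (j + 1) := mul_nonneg (by omega) (by omega)
  have hk2 : 0 ≤ (102 - j) * (j - 15) := mul_nonneg (by omega) (by omega)
  nlinarith [hdiv, hk1, hk2, hc, hrin, hX]

/-- Floor-free failure of the top-label cell, `k = 9`, member `A = 10` (`e = 10l`, `m = 90`), turning point `a₀ = 4`, `103 ≤ j ≤ 158`. [folklore] -/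
theorem RefBand.not_hullCell_hex9low_A10_a4 {j rin : ℤ} (hlo : 103 ≤ j) (hhi : j ≤ 158) (hrin : 6 * rin ≤ 10 * (2 * j + 1) + 6) :
    ¬ HullCell (10 * (2 * j + 1)) 90 j rin (2401 - 4 * (10 * (2 * j + 1))) := by
  intro hc
  unfold HullCell at hc
  set e : ℤ := 10 * (2 * j + 1) with he
  have he0 : 0 < e := by rw [he]; omega
  set X : ℤ := j ^ 2 * 90 - j * (e - 1) - (j + 1) * rin with hX
  have hdiv : X - e < e * (X / e) := by
    have h1 := Int.emod_add_mul_ediv X e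
    have h2 := Int.emod_lt_of_pos X he0
    have h3 := Int.emod_nonneg X he0.ne'
    nlinarith [h1, h2, h3]
  have hk1 : 0 ≤ (158 - j) * (j + 1) := mul_nonneg (by omega) (by omega)
  have hk2 : 0 ≤ (158 - j) * (j - 103) := mul_nonneg (by omega) (by omega)
  nlinarith [hdiv, hk1, hk2, hc, hrin, hX]

/-- **HEX `k = 9`, low range: the engine's `hcell` at `(7, v = 9)`, odd `11 ≤ l ≤ 317`, top label; the sharp class is `A ∈ {5, 10}`.** [folklore] -/
theorem RefBand.cells_hex9_low {l : ℕ} (hlo : 11 ≤ l) (hhi : l ≤ 317) (hodd : Odd l) {i : ℕ} (hi : i + 1 = (l - 1) / 2)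
    (A : ℕ) (hA30 : A ∣ 30) (hA15 : 15 ∣ A * 9) (_hAev : Even 9 → A ∣ 15) (hA3 : 3 ∣ 9 → A ∣ 10) (_hA5 : 5 ∣ 9 → A ∣ 6) :
    ∃ a₀ : ℕ, (∀ s : ℕ, s < a₀ → (1 : ℤ) * ((7 : ℕ) : ℤ) ^ s * (((7 : ℕ) : ℤ) - 1) < ((A * l : ℕ) : ℤ)) ∧
      ((A * l : ℕ) : ℤ) ≤ 1 * ((7 : ℕ) : ℤ) ^ a₀ * (((7 : ℕ) : ℤ) - 1) ∧
      ¬ HullCell ((A * l : ℕ) : ℤ) ((A * 9 : ℕ) : ℤ) ((i : ℤ) + 1) (((A * l) / ((7 : ℕ) - 1) + 1 : ℕ) : ℤ)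
        (((7 : ℕ) : ℤ) ^ a₀ - (a₀ : ℤ) * ((A * l : ℕ) : ℤ)) := by
  have hA31 : A ≤ 30 := Nat.le_of_dvd (by norm_num) hA30
  have hcl2 : A ∣ 10 := hA3 (by decide)
  have hA : A = 5 ∨ A = 10 := by
    interval_cases A <;> first | exact Or.inl rfl | exact Or.inr rfl | (exfalso; revert hA30 hA15 hcl2; decide)
  obtain ⟨j, hj⟩ := hodd
  have hij : (i : ℤ) + 1 = (j : ℤ) := by
    have : i + 1 = j := by omega
    exact_mod_cast this
  rcases hA with rfl | rfl
  · have hrin : (6 : ℤ) * (((((5 * l) / ((7 : ℕ) - 1) + 1 : ℕ) : ℤ))) ≤ 5 * (2 * (j : ℤ) + 1) + 6 := by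
      have h0 : ((7 : ℕ) - 1) * ((5 * l) / ((7 : ℕ) - 1)) ≤ 5 * l := Nat.mul_div_le _ _
      have h1 : (6 : ℤ) * ((((5 * l) / ((7 : ℕ) - 1) : ℕ) : ℤ)) ≤ ((5 * l : ℕ) : ℤ) := by exact_mod_cast h0
      push_cast at h1 ⊢; omega
    have he : ((5 * l : ℕ) : ℤ) = 5 * (2 * (j : ℤ) + 1) := by push_cast; omega
    have hm : ((5 * 9 : ℕ) : ℤ) = 45 := by norm_num
    by_cases hp0 : 11 ≤ l ∧ l ≤ 57
    · refine ⟨2, fun s hs => ?_, ?_, ?_⟩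
      · interval_cases s <;> norm_num <;> omega
      · norm_num; omega
      · have hro : (((7 : ℕ) : ℤ) ^ 2 - ((2 : ℕ) : ℤ) * ((5 * l : ℕ) : ℤ)) = 49 - 2 * (5 * (2 * (j : ℤ) + 1)) := by
          push_cast; omega
        rw [hro, hij, he, hm]
        exact RefBand.not_hullCell_hex9low_A5_a2 (by omega) (by omega) hrin
    by_cases hp1 : 59 ≤ l ∧ l ≤ 317
    · refine ⟨3, fun s hs => ?_, ?_, ?_⟩
      · interval_cases s <;> norm_num <;> omega
      · norm_num; omega
      · have hro : (((7 : ℕ) : ℤ) ^ 3 - ((3 : ℕ) : ℤ) * ((5 * l : ℕ) : ℤ)) = 343 - 3 * (5 * (2 * (j : ℤ) + 1)) := by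
          push_cast; omega
        rw [hro, hij, he, hm]
        exact RefBand.not_hullCell_hex9low_A5_a3 (by omega) (by omega) hrin
    exfalso; omega
  · have hrin : (6 : ℤ) * (((((10 * l) / ((7 : ℕ) - 1) + 1 : ℕ) : ℤ))) ≤ 10 * (2 * (j : ℤ) + 1) + 6 := by
      have h0 : ((7 : ℕ) - 1) * ((10 * l) / ((7 : ℕ) - 1)) ≤ 10 * l := Nat.mul_div_le _ _
      have h1 : (6 : ℤ) * ((((10 * l) / ((7 : ℕ) - 1) : ℕ) : ℤ)) ≤ ((10 * l : ℕ) : ℤ) := by exact_mod_cast h0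
      push_cast at h1 ⊢; omega
    have he : ((10 * l : ℕ) : ℤ) = 10 * (2 * (j : ℤ) + 1) := by push_cast; omega
    have hm : ((10 * 9 : ℕ) : ℤ) = 90 := by norm_num
    by_cases hp0 : 11 ≤ l ∧ l ≤ 29
    · refine ⟨2, fun s hs => ?_, ?_, ?_⟩
      · interval_cases s <;> norm_num <;> omega
      · norm_num; omega
      · have hro : (((7 : ℕ) : ℤ) ^ 2 - ((2 : ℕ) : ℤ) * ((10 * l : ℕ) : ℤ)) = 49 - 2 * (10 * (2 * (j : ℤ) + 1)) := by
          push_cast; omega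
        rw [hro, hij, he, hm]
        exact RefBand.not_hullCell_hex9low_A10_a2 (by omega) (by omega) hrin
    by_cases hp1 : 31 ≤ l ∧ l ≤ 205
    · refine ⟨3, fun s hs => ?_, ?_, ?_⟩
      · interval_cases s <;> norm_num <;> omega
      · norm_num; omega
      · have hro : (((7 : ℕ) : ℤ) ^ 3 - ((3 : ℕ) : ℤ) * ((10 * l : ℕ) : ℤ)) = 343 - 3 * (10 * (2 * (j : ℤ) + 1)) := by
          push_cast; omega
        rw [hro, hij, he, hm]
        exact RefBand.not_hullCell_hex9low_A10_a3 (by omega) (by omega) hrin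
    by_cases hp2 : 207 ≤ l ∧ l ≤ 317
    · refine ⟨4, fun s hs => ?_, ?_, ?_⟩
      · interval_cases s <;> norm_num <;> omega
      · norm_num; omega
      · have hro : (((7 : ℕ) : ℤ) ^ 4 - ((4 : ℕ) : ℤ) * ((10 * l : ℕ) : ℤ)) = 2401 - 4 * (10 * (2 * (j : ℤ) + 1)) := by
          push_cast; omega
        rw [hro, hij, he, hm]
        exact RefBand.not_hullCell_hex9low_A10_a4 (by omega) (by omega) hrin
    exfalso; omega

/-! ## §2. The M-line glue `11 ≤ l ≤ 337` -/

/-- **HEX `k = 9`, M LINE: S_H at the summand-route M-level setting of the datum's OWN ideles REFUTED at EVERY genuine datum over `(ratPoint (1/2 + 2/7^9), l)` for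
EVERY prime `11 ≤ l ≤ 337`** — the M twin of `GenuineK.not_pilotKummerCompatHull_chosen_lamSeven_nine_le`, SAME binders: `l ≤ 317` by §1 through this seat's
`GenuineM.not_pilotKummerCompatHull_triple_of_hullCells_tameSharp`, `{331, 337}` by the gap twin (no prime in `318 … 330`). The inhabited side, admissibility /
(P6) / non-emptiness NOT claimed; refuted-as-typed only. [cite: Mochizuki2012, IUTchIII Cor. 3.12 Step (xi-f) p. 184] [cite: DupuyHilado2025, §4.9]
[claim: Mochizuki2012, status: disputed] -/
theorem GenuineM.not_pilotKummerCompatHull_triple_lamSeven_nine_le {k l : ℕ} (hk : k = 9) (hl : l.Prime) (h11 : 11 ≤ l) (h337 : l ≤ 337)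
    (T : Cor22.ThetaVolumeDatumAt (ratPoint ((2 : ℚ)⁻¹ + 2 / 7 ^ k)) l) :
    letI := T.instFieldF; letI := T.instNumberFieldF; letI := T.instAlgebraF; letI := T.instFieldK
    letI := T.instNumberFieldK; letI := T.instAlgebraK; letI := T.instFieldFbar; letI := T.instAlgebraFbar
    letI := T.instAlgebraKFbar; letI := T.instIsElliptic
    ∀ (M : Type) [Field M] [NumberField M]
      (archPk : ∀ (j : (thetaIndexOfInitial T.D).Label) (vQ : (thetaIndexOfInitial T.D).VQ),
        Set ((logShellsOfInitialDH T.D (analyticLogvVal T.K)).Packet j vQ))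
      (archSub : ∀ (j : (thetaIndexOfInitial T.D).Label) (v : (thetaIndexOfInitial T.D).V),
        Set ((logShellsOfInitialDH T.D (analyticLogvVal T.K)).Packet j ((thetaIndexOfInitial T.D).over v)))
      (Ψ : ℤ → ∀ v : (thetaIndexOfInitial T.D).V, v ∈ (thetaIndexOfInitial T.D).Vbad →
        Set ((logShellsOfInitialDH T.D (analyticLogvVal T.K)).StarPacket v))
      (act : ℤ → ∀ v : (thetaIndexOfInitial T.D).V, v ∈ (thetaIndexOfInitial T.D).Vbad →
        (logShellsOfInitialDH T.D (analyticLogvVal T.K)).StarPacket v →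
          Module.End ℚ ((logShellsOfInitialDH T.D (analyticLogvVal T.K)).StarPacket v))
      (Mmod : ℤ → ∀ j : (thetaIndexOfInitial T.D).LabelStar, Set ((logShellsOfInitialDH T.D (analyticLogvVal T.K)).GlobalPacket j.1))
      (region : ℤ → ∀ j : (thetaIndexOfInitial T.D).LabelStar, FinDivisor M → ∀ vQ : (thetaIndexOfInitial T.D).VQ,
        Set ((logShellsOfInitialDH T.D (analyticLogvVal T.K)).Packet j.1 vQ))
      (frobAdm : ℤ → ℤ → ∀ (j : (thetaIndexOfInitial T.D).Label) (vQ : (thetaIndexOfInitial T.D).VQ),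
        Set ((logShellsOfInitialDH T.D (analyticLogvVal T.K)).Packet j vQ) → Prop)
      (frobLogvol : ℤ → ℤ → ∀ (j : (thetaIndexOfInitial T.D).Label) (vQ : (thetaIndexOfInitial T.D).VQ),
        Set ((logShellsOfInitialDH T.D (analyticLogvVal T.K)).Packet j vQ) → ℝ)
      (frobΨ : ℤ → ℤ → ∀ v : (thetaIndexOfInitial T.D).V, v ∈ (thetaIndexOfInitial T.D).Vbad →
        Set ((logShellsOfInitialDH T.D (analyticLogvVal T.K)).StarPacket v))
      (frobMmod : ℤ → ℤ → ∀ j : (thetaIndexOfInitial T.D).LabelStar, Set ((logShellsOfInitialDH T.D (analyticLogvVal T.K)).GlobalPacket j.1))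
      (unitImage : ℤ → ℤ → ℕ → ∀ (j : (thetaIndexOfInitial T.D).Label) (vQ : (thetaIndexOfInitial T.D).VQ),
        Set ((logShellsOfInitialDH T.D (analyticLogvVal T.K)).Packet j vQ))
      (ballImage : ℤ → ℤ → ∀ (j : (thetaIndexOfInitial T.D).Label) (vQ : (thetaIndexOfInitial T.D).VQ),
        Set ((logShellsOfInitialDH T.D (analyticLogvVal T.K)).Packet j vQ))
      (thetaDiv : ℤ → ℤ → LgpDivisor M (thetaIndexOfInitial T.D).lstar)
      (n : ℤ) {HT : Type} {LogLink : HT → HT → Type} {IsFull : ∀ {s t : HT}, LogLink s t → Prop}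
      (lat : LGPGaussianLogThetaLattice LogLink IsFull)
      {Frd : Type} {IsoF : Frd → Frd → Type} {Ob : Frd → Type} {realify : Frd → Frd} {Strip : Type}
      {IsoS : Strip → Strip → Type} {Mv : ∀ v : (thetaIndexOfInitial T.D).V, v ∈ (thetaIndexOfInitial T.D).Vbad → Type}
      [∀ v h, Monoid (Mv v h)]
      (sig : GlobalLGPFrobenioidSignature (thetaIndexOfInitial T.D).lstar (thetaIndexOfInitial T.D).V
        (· ∈ (thetaIndexOfInitial T.D).Vbad) Frd IsoF Ob realify Strip IsoS Mv)
      (split : SplittingMonoids Mv) {ObΔ : Type} {N : ∀ v : (thetaIndexOfInitial T.D).V, v ∈ (thetaIndexOfInitial T.D).Vbad → Type}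
      [∀ v h, Monoid (N v h)] (qData : QPilotData ObΔ N)
      (qK : ∀ v : (thetaIndexOfInitial T.D).V, v ∈ (thetaIndexOfInitial T.D).Vbad →
        Set ((logShellsOfInitialDH T.D (analyticLogvVal T.K)).StarPacket v)),
      ¬ Cor312Vol.PilotKummerCompatHull
        (LatticeSituation.ofShells (logShellsOfInitialDH T.D (analyticLogvVal T.K)) M archPk archSub
          (summandPiecesPrM T.D (logvAnalyticVal_analyticLogvVal (K := T.K))).Adm (summandPiecesPrM T.D (logvAnalyticVal_analyticLogvVal (K := T.K))).logvol Ψ act Mmod region frobAdm frobLogvol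
          frobΨ frobMmod unitImage ballImage thetaDiv)
        (settingPrVolSharpM T.D (logvAnalyticVal_analyticLogvVal (K := T.K)) (tOfIdeleData T.D (ideleDataOf T.D T.isVolumeInputOf))
          (fun u x => tqM T.D (ratChar u) u (natCast_ratChar_mem u) (ideleDataOf T.D T.isVolumeInputOf) x) M archPk archSub Ψ act Mmod region n lat sig split qData
          (fun u x => tqM_ne_zero T.D (ratChar u) u (natCast_ratChar_mem u) (ideleDataOf T.D T.isVolumeInputOf) x)
          (GenuineM.finite_ratPlaces_under_S T.D).toFinset
          (fun u x hu => norm_tqM_eq_one_of_not_mem T.D (ratChar u) u (natCast_ratChar_mem u) (ideleDataOf T.D T.isVolumeInputOf) x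
            fun hx => hu ((Set.Finite.mem_toFinset _).mpr ⟨x, hx⟩)))
        (fun _ => Cor312.Setting.qRegion
          (settingPrVolSharpM T.D (logvAnalyticVal_analyticLogvVal (K := T.K)) (tOfIdeleData T.D (ideleDataOf T.D T.isVolumeInputOf))
          (fun u x => tqM T.D (ratChar u) u (natCast_ratChar_mem u) (ideleDataOf T.D T.isVolumeInputOf) x) M archPk archSub Ψ act Mmod region n lat sig split qData
          (fun u x => tqM_ne_zero T.D (ratChar u) u (natCast_ratChar_mem u) (ideleDataOf T.D T.isVolumeInputOf) x)
          (GenuineM.finite_ratPlaces_under_S T.D).toFinset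
          (fun u x hu => norm_tqM_eq_one_of_not_mem T.D (ratChar u) u (natCast_ratChar_mem u) (ideleDataOf T.D T.isVolumeInputOf) x
            fun hx => hu ((Set.Finite.mem_toFinset _).mpr ⟨x, hx⟩)))) qK := by
  have hodd : Odd l := hl.odd_of_ne_two (by omega)
  by_cases h317 : l ≤ 317
  · subst hk
    revert T
    rw [lamSeven_eq_hex9]
    intro T
    exact GenuineM.not_pilotKummerCompatHull_triple_of_hullCells_tameSharp isABCTriple_hex9 T (placeOfPrimeQ 7 (by norm_num)) 7
      (ratChar_placeOfPrimeQ 7 (by norm_num)) (by norm_num) (by norm_num) (by norm_num) (by omega) (by norm_num) factorization_triple_hex9_seven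
      (i := (l - 1) / 2 - 1) (by omega)
      (fun A hA30 hA15 hAev hA3 hA5 => RefBand.cells_hex9_low h11 h317 hodd (by omega) A hA30 hA15 hAev hA3 hA5)
  · have h : l = 331 ∨ l = 337 := by
      have h318 : 318 ≤ l := by omega
      interval_cases l <;> first | exact Or.inl rfl | exact Or.inr rfl | exact absurd hl (by norm_num)
    exact GenuineM.not_pilotKummerCompatHull_triple_lamSeven_nine_gap hk hl h T

end Summit.ABC.IUTFork.Conditional

end
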